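import Mathlib
import HarnessLib

/-!
# Cartesian products and product rules (Davis–Rabinowitz 1984, Sect. 5.6)

Davis–Rabinowitz, *Methods of Numerical Integration* (2nd ed., 1984), Sect. 5.6 "Cartesian Products and Product
Rules", pp. 354–356: for an `m`-point rule `R(f) = Σ_j w_j f(x_j)` over `B` (5.6.1) and an `n`-point rule
`S(f) = Σ_k v_k f(y_k)` over `G` (5.6.2), the *product rule* is the `mn`-point rule
`(R × S)(f) = Σ_j Σ_k w_j v_k f(x_j, y_k)` over `B × G` (5.6.3).  THEOREM: if `R` integrates `f` exactly over `B`
and `S` integrates `g` exactly over `G`, then `R × S` integrates `h(x, y) = f(x) g(y)` exactly over `B × G`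
(proof: Fubini and `Σ_j Σ_k w_j v_k f(x_j) g(y_k) = (Σ_j w_j f(x_j)) (Σ_k v_k g(y_k))`).  Example (5.6.4): the
product of two Simpson rules on the rectangle `[a, b] × [c, d]` is the 9-point rule
`hk/36 [f(a,c) + f(a,d) + f(b,c) + f(b,d) + 4(f(a,n) + f(m,c) + f(b,n) + f(m,d)) + 16 f(m,n)]`
(`m, n` the midpoints, `h = b - a`, `k = d - c`), exact for the 16 monomials `xⁱ yʲ`, `0 ≤ i, j ≤ 3`.

Recorded: `productRule` (5.6.3) for rules with arbitrary finite index types and node spaces; the separation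
identity; the THEOREM in abstract form (any pair of "integral" functionals) and for iterated interval integrals
over a rectangle, also for finite sums of separable functions; `productSimpson` (5.6.4), its identification as the
product rule of two Simpson rules, and its exactness on `p(x) q(y)`, `deg p, deg q ≤ 3`.  The `d`-fold
tensor rule on `[0,1]^d` with its error induction is the tree's `TensorProductRuleError` (`TensorRule.*`,
after Vysotsky–Smirnov–Tyrtyshnikov 2021); this file is the two-factor algebra of DR84 Sect. 5.6.

Provenance: engines group, shared numerical engines serving client cells; rigour lives in the verifiers; every
published number belongs to a client cell's ledger, not to the engines group.  Textbook facts only (no client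
numbers).
-/

namespace Literature.Analysis.Quadrature

open Set MeasureTheory intervalIntegral Finset Polynomial
open scoped Real Interval

noncomputable section

variable {ι κ α β : Type*} [Fintype ι] [Fintype κ]

/-- The product rule `(R × S)(h) = Σ_j Σ_k w_j v_k h(x_j, y_k)` of `R = (w, x)` and `S = (v, y)`.
[cite: DavisRabinowitz1984, Sect. 5.6 (5.6.3)] -/
def productRule (w : ι → ℝ) (x : ι → α) (v : κ → ℝ) (y : κ → β) (h : α → β → ℝ) : ℝ :=
  ∑ j, ∑ k, w j * v k * h (x j) (y k)

/-- Separation: on `h(x, y) = f(x) g(y)` the product rule is the product of the two rules.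
[cite: DavisRabinowitz1984, Sect. 5.6 (5.6.3)] -/
theorem productRule_mul (w : ι → ℝ) (x : ι → α) (v : κ → ℝ) (y : κ → β) (f : α → ℝ) (g : β → ℝ) :
    productRule w x v y (fun s t => f s * g t) = (∑ j, w j * f (x j)) * ∑ k, v k * g (y k) := by
  rw [productRule, Finset.sum_mul_sum]
  refine Finset.sum_congr rfl fun j _ => Finset.sum_congr rfl fun k _ => ?_
  ring

/-- The product rule is linear in the integrand (finite sums). [cite: DavisRabinowitz1984, Sect. 5.6 (5.6.3)] -/
theorem productRule_finset_sum {L : Type*} (w : ι → ℝ) (x : ι → α) (v : κ → ℝ) (y : κ → β) (s : Finset L)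
    (h : L → α → β → ℝ) :
    productRule w x v y (fun a b => ∑ l ∈ s, h l a b) = ∑ l ∈ s, productRule w x v y (h l) := by
  simp only [productRule, Finset.mul_sum]
  symm
  rw [Finset.sum_comm]
  exact Finset.sum_congr rfl fun j _ => Finset.sum_comm

/-- THEOREM of Sect. 5.6 (abstract form): if `R` integrates `f` exactly (w.r.t. a functional `I_B`) and `S`
integrates `g` exactly (w.r.t. `I_G`), then `R × S` integrates `f(x) g(y)` exactly w.r.t. the product value
`I_B(f) I_G(g)`. [cite: DavisRabinowitz1984, Sect. 5.6 Theorem] -/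
theorem productRule_mul_eq_of_exact {w : ι → ℝ} {x : ι → α} {v : κ → ℝ} {y : κ → β} {f : α → ℝ} {g : β → ℝ}
    {IBf IGg : ℝ} (hR : ∑ j, w j * f (x j) = IBf) (hS : ∑ k, v k * g (y k) = IGg) :
    productRule w x v y (fun s t => f s * g t) = IBf * IGg := by
  rw [productRule_mul, hR, hS]

/-- Fubini for a separable integrand on a rectangle (iterated interval integrals).
[cite: DavisRabinowitz1984, Sect. 5.6 Theorem (proof)] -/
theorem integral_integral_mul_separable (f g : ℝ → ℝ) (a b c d : ℝ) :
    ∫ s in a..b, ∫ t in c..d, f s * g t = (∫ s in a..b, f s) * ∫ t in c..d, g t := by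
  simp_rw [intervalIntegral.integral_const_mul]
  rw [intervalIntegral.integral_mul_const]

/-- THEOREM of Sect. 5.6 on a rectangle `[a, b] × [c, d]`: `R` exact on `f` over `[a, b]` and `S` exact on `g`
over `[c, d]` imply `R × S` exact on `f(x) g(y)`. [cite: DavisRabinowitz1984, Sect. 5.6 Theorem] -/
theorem integral_integral_mul_eq_productRule {w : ι → ℝ} {x : ι → ℝ} {v : κ → ℝ} {y : κ → ℝ} {f g : ℝ → ℝ}
    {a b c d : ℝ} (hR : ∑ j, w j * f (x j) = ∫ s in a..b, f s) (hS : ∑ k, v k * g (y k) = ∫ t in c..d, g t) :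
    ∫ s in a..b, ∫ t in c..d, f s * g t = productRule w x v y (fun s t => f s * g t) := by
  rw [integral_integral_mul_separable, productRule_mul_eq_of_exact hR hS]

/-- The same for a finite sum of separable functions `h(x, y) = Σ_l f_l(x) g_l(y)` ("all linear combinations
of the monomials …"). [cite: DavisRabinowitz1984, Sect. 5.6 Theorem, (5.6.4)] -/
theorem integral_integral_sum_mul_eq_productRule {L : Type*} {w : ι → ℝ} {x : ι → ℝ} {v : κ → ℝ} {y : κ → ℝ}
    (s : Finset L) {f g : L → ℝ → ℝ} {a b c d : ℝ} (hf : ∀ l ∈ s, IntervalIntegrable (f l) volume a b)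
    (hg : ∀ l ∈ s, ∀ z, IntervalIntegrable (fun t => f l z * g l t) volume c d)
    (hR : ∀ l ∈ s, ∑ j, w j * f l (x j) = ∫ z in a..b, f l z)
    (hS : ∀ l ∈ s, ∑ k, v k * g l (y k) = ∫ t in c..d, g l t) :
    ∫ z in a..b, ∫ t in c..d, ∑ l ∈ s, f l z * g l t = productRule w x v y (fun z t => ∑ l ∈ s, f l z * g l t) := by
  rw [productRule_finset_sum]
  have h1 : ∀ z, ∫ t in c..d, ∑ l ∈ s, f l z * g l t = ∑ l ∈ s, f l z * ∫ t in c..d, g l t := fun z => by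
    rw [intervalIntegral.integral_finsetSum fun l hl => hg l hl z]
    simp_rw [intervalIntegral.integral_const_mul]
  simp_rw [h1]
  rw [intervalIntegral.integral_finsetSum fun l hl => (hf l hl).mul_const _]
  refine Finset.sum_congr rfl fun l hl => ?_
  rw [intervalIntegral.integral_mul_const, ← integral_integral_mul_separable,
    integral_integral_mul_eq_productRule (hR l hl) (hS l hl)]

/-! ### (5.6.4): the product of two Simpson rules -/

/-- Simpson's weights `(h/6)(1, 4, 1)` as `Fin 3`-indexed data. [cite: DavisRabinowitz1984, Sect. 5.6 (5.6.4)] -/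
def simpsonWeight (a b : ℝ) : Fin 3 → ℝ := ![(b - a) / 6, 4 * (b - a) / 6, (b - a) / 6]

/-- Simpson's nodes `a, (a+b)/2, b` as `Fin 3`-indexed data. [cite: DavisRabinowitz1984, Sect. 5.6 (5.6.4)] -/
def simpsonNode (a b : ℝ) : Fin 3 → ℝ := ![a, (a + b) / 2, b]

/-- The 9-point product Simpson rule (5.6.4) on `[a, b] × [c, d]`. [cite: DavisRabinowitz1984, Sect. 5.6 (5.6.4)] -/
def productSimpson (f : ℝ → ℝ → ℝ) (a b c d : ℝ) : ℝ :=
  (b - a) * (d - c) / 36 *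
    (f a c + f a d + f b c + f b d +
      4 * (f a ((c + d) / 2) + f ((a + b) / 2) c + f b ((c + d) / 2) + f ((a + b) / 2) d) +
      16 * f ((a + b) / 2) ((c + d) / 2))

/-- (5.6.4) is the product rule of two Simpson rules. [cite: DavisRabinowitz1984, Sect. 5.6 (5.6.4)] -/
theorem productSimpson_eq_productRule (f : ℝ → ℝ → ℝ) (a b c d : ℝ) :
    productSimpson f a b c d =
      productRule (simpsonWeight a b) (simpsonNode a b) (simpsonWeight c d) (simpsonNode c d) f := by
  simp only [productSimpson, productRule, simpsonWeight, simpsonNode, Fin.sum_univ_three, Matrix.cons_val_zero,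
    Matrix.cons_val_one, Matrix.cons_val]
  ring

/-- [folklore] `∫_a^b p = Σ_{i<n} c_i (b^{i+1} - a^{i+1})/(i+1)` for `deg p < n`. -/
private theorem integral_eval_eq_sum'' (p : ℝ[X]) {n : ℕ} (hn : p.natDegree < n) (a b : ℝ) :
    ∫ x in a..b, p.eval x = ∑ i ∈ range n, p.coeff i * ((b ^ (i + 1) - a ^ (i + 1)) / (i + 1)) := by
  simp_rw [eval_eq_sum_range' hn]
  rw [intervalIntegral.integral_finsetSum fun i _ => ?_]
  · refine Finset.sum_congr rfl fun i _ => ?_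
    rw [intervalIntegral.integral_const_mul, integral_pow]
  · exact (continuous_const.mul (continuous_pow i)).intervalIntegrable _ _

/-- Simpson's rule (as `Fin 3` data) is exact for cubics. [cite: DavisRabinowitz1984, Sect. 5.6 (5.6.4)] -/
theorem sum_simpsonWeight_mul_eq_integral (p : ℝ[X]) (hp : p.natDegree ≤ 3) (a b : ℝ) :
    ∑ j, simpsonWeight a b j * p.eval (simpsonNode a b j) = ∫ s in a..b, p.eval s := by
  have hn : p.natDegree < 4 := by omega
  rw [integral_eval_eq_sum'' p hn]
  simp only [simpsonWeight, simpsonNode, Fin.sum_univ_three, Matrix.cons_val_zero, Matrix.cons_val_one,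
    Matrix.cons_val, eval_eq_sum_range' hn, Finset.sum_range_succ, Finset.sum_range_zero]
  push_cast
  ring

/-- (5.6.4): the 9-point product Simpson rule integrates `p(x) q(y)` exactly for `deg p, deg q ≤ 3` — hence all
linear combinations of the 16 monomials `xⁱ yʲ`, `0 ≤ i, j ≤ 3`. [cite: DavisRabinowitz1984, Sect. 5.6 (5.6.4)] -/
theorem integral_integral_eq_productSimpson (p q : ℝ[X]) (hp : p.natDegree ≤ 3) (hq : q.natDegree ≤ 3)
    (a b c d : ℝ) :
    ∫ s in a..b, ∫ t in c..d, p.eval s * q.eval t = productSimpson (fun s t => p.eval s * q.eval t) a b c d := by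
  rw [productSimpson_eq_productRule]
  exact integral_integral_mul_eq_productRule (sum_simpsonWeight_mul_eq_integral p hp a b)
    (sum_simpsonWeight_mul_eq_integral q hq c d)

/-- The monomial form: `∫_a^b ∫_c^d xⁱ yʲ` by the product Simpson rule, `i, j ≤ 3`.
[cite: DavisRabinowitz1984, Sect. 5.6 (5.6.4)] -/
theorem integral_integral_pow_mul_pow_eq_productSimpson {i j : ℕ} (hi : i ≤ 3) (hj : j ≤ 3) (a b c d : ℝ) :
    ∫ s in a..b, ∫ t in c..d, s ^ i * t ^ j = productSimpson (fun s t => s ^ i * t ^ j) a b c d := by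
  have := integral_integral_eq_productSimpson (X ^ i) (X ^ j) (by simpa using hi) (by simpa using hj) a b c d
  simpa using this

end

end Literature.Analysis.Quadrature
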